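import Summits.BirchSwinnertonDyer.BirchSwinnertonDyer.Theorems.GenusKolyvaginAtTwoGenusPrimitiveSupplyAtTwoPosDiscShallowKFourPosCellTrichotomy
import Summits.BirchSwinnertonDyer.BirchSwinnertonDyer.Theorems.GenusKolyvaginAtTwoShaCardDvdPowAtTwoPosTDefectOneBitLaw
import Summits.BirchSwinnertonDyer.BirchSwinnertonDyer.Theorems.GenusKolyvaginAtTwoShaCorestrictionQuadratic
import Summits.BirchSwinnertonDyer.BirchSwinnertonDyer.Theorems.GenusKolyvaginAtTwoShaCardDvdPowAtTwoPosTOnCut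
import Summits.BirchSwinnertonDyer.BirchSwinnertonDyer.Theorems.AdditiveKolyvaginRoadShaEigenParity
import Literature.NumberTheory.EllipticCurves.SelmerGaloisAction
import Literature.NumberTheory.EllipticCurves.KummerMap
import HarnessLib

/-!
# Route `GenusKolyvaginAtTwo`, crux K₄⁺ `K4Pos` (stmt-BirchSwinnertonDyer-31469) — COMPLEX CONJUGATION ACTS TRIVIALLY ON `Sel_(2^k)(E_K/K)`
# MODULO THE MORDELL–WEIL IMAGE; on the K₄⁺ cell `(σ − 1)·Sel₂(E_K/K) ∋ κ₂(Q₀)` for every `Q₀ ∉ 2E(K)` (e.g. `Q₀ = y_K/2^(M₀)`)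

Width seat `bsd-line-gk2-p5` g37 (cell `bsd-f1-sign2`), `--supports stmt-BirchSwinnertonDyer-31469 --as helper`.  THEOREMS ONLY (no definition, no named
fact, no `sorry`); standard axioms.  **BSD is NOT proved by this file; K4Pos is NOT proved; nothing is closed.**

WHY.  The g36 memo (`B2Q-FLAT-HALVING-DESCENT-gk2p5-g36.md`, addendum) proposed a depth-two INSTRUMENT in `2`-descent-over-`K` currency: «K₄ at `M₀ = 2` ⟹
`κ₂(y_K/4) = u₀`, `u₀` the generator of `(σ−1)·Sel₂(E_K/K)`».  This file shows that the proposed test is IDLE — it holds identically, at every depth,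
with no K₄ hypothesis — and records the structural law behind it:
* §1 `conjAct_sub_self_mem_range_kummerMapTorsion` — **for ANY `E/ℚ`, `K` imaginary quadratic, `σ ≠ 1`, and a twist `T = E^(d_K)` with
  `Ш(T/ℚ)[2^∞] = 0` (displayed): `σ·m − m ∈ κ_n(E(K))` for every `m ∈ Sel_(n)(E_K/K)`, `n = 2^k`** — complex conjugation acts TRIVIALLY on
  `Sel_(2^k)(E_K/K)/κ(E(K))`.  Proof: `ι(σm − m) = σ·ι(m) − ι(m)` (`AdditiveKoly.torsionH1ToH1_conjAct`), `ι(m) ∈ Ш(E_K/K)[2^k]` (Kummer,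
  `map_torsionH1ToH1_selmerGroup_holds`), `σ = id` on `Ш(E_K/K)[2^∞]` (gk2-p4 g27 `OneBit.conjH1Points_eq_self_of_shaPrimary`, its `hcorT` discharged by
  g28 `ShaCores.corBaseChange_mem_sha`), exactness of the Kummer sequence at `H¹(K, E[n])` (`mem_range_kummerMapTorsion_of_torsionH1ToH1_eq_zero`).
* §2 `conjAct_sub_self_mem_range_kummerMapTorsion_of_frame` — the same on the supply cruxes' frame (K4Pos / K4Neg: Heegner datum with `P(1)` of
  infinite order and `2^(M₀+1) ∤ P(1)`, `w(E) = +1`, `rank E(ℚ) = 0` displayed, a twin with `#Sel₂(Wd) = 2`), where `Ш(T/ℚ)[2^∞] = 0` is gk2-p3's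
  `exists_frame_of_cut`.  SIGN-FREE.
* §3 `exists_conjAct_sub_self_eq_kummerMapTorsion_of_kFourPos` — **on the K₄⁺ cell, for EVERY `Q₀ ∈ E(K) ∖ 2E(K)` some `m ∈ Sel₂(E_K/K)` has
  `σ·m − m = κ₂(Q₀)`**: `(σ−1)·Sel₂(E_K/K) ⊆ κ₂(E(K)) = {0, κ₂(Q₀)}` (§1 + g35 `KFourPosCell.kummerMapTorsion_eq_zero_or_eq_of_rank_one`), and
  `(σ−1)·Sel₂(E_K/K) ≠ 0` because `#Sel₂(E_K/K)^σ = 4 < 8 = #Sel₂(E_K/K)` (g35 `natCard_fixedSelmer_eq_four_of_kFourPos`,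
  `natCard_shaTorsionBy_two_baseChange_eq_four_of_kFourPos`).  With `Q₀ = y_K/2^(M₀)` (LEAD / g35 capitulation package) this is «`u₀ = κ₂(y_K/2^(M₀))`»
  UNCONDITIONALLY: the memo's depth-two test cannot fail, hence detects nothing.  (The depth-two instruments that remain are the ℚ-side ones:
  `#Sel₄(E/ℚ) ≠ 4` (this seat, `…KFourPosSelmerCountCurrency`) ⟺ the Cassels–Tate pairing on `Sel₂(E/ℚ)` vanishes (LEAD-BRIEF-g23-ADDENDUM B.4).)
BSD is NOT proved by any of this.

References: [GrossLMS1991] §5 (5.1), Prop. 5.3; [Kramer1981] Thm. 1; [SilvermanAEC2009] VIII.§2, Thm. X.4.2; [SerreGaloisCohomology1997] I §2.4 Prop. 9;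
[McCallumLMS1991] §5.
-/

set_option autoImplicit false
-- the Theorems namespace of this sub repeats the summit name by design (D-0017 nested layout)
set_option linter.dupNamespace false

noncomputable section

open scoped Classical
open scoped AddSubgroup

namespace Summit.BirchSwinnertonDyer.BirchSwinnertonDyer.Theorems.GenusExact.PlusDescent

open WeierstrassCurve NumberField IsDedekindDomain Field Literature.NumberTheory.EllipticCurves
  Literature.NumberTheory.GaloisRepresentations Literature.NumberTheory.EllipticCurves.ModularForms AddSubgroup
  Literature.NumberTheory.EllipticCurves.RingClassField Literature.NumberTheory.GaloisCohomology
open Summit.BirchSwinnertonDyer.BirchSwinnertonDyer.Theorems.GenusSupplyNarrow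
open Summit.BirchSwinnertonDyer.BirchSwinnertonDyer.Theorems.AdditiveKoly (torsionH1ToH1_conjAct)

/-! ## §1 `σ·m − m ∈ κ_n(E(K))` for every `m ∈ Sel_(n)(E_K/K)`, `n = 2^k`, when `Ш(E^(d_K)/ℚ)[2^∞] = 0` -/

/-- **Complex conjugation acts trivially on `Sel_(2^k)(E_K/K)` modulo the Mordell–Weil image.**  `E = W/ℚ` elliptic, `K` imaginary quadratic,
`σ ∈ Aut(K/ℚ)` non-trivial, and the twist `T = W.quadraticTwist d_K` with `Ш(T/ℚ)[2^∞] = 0` (displayed binder `hT0`, as in gk2-p4's one-bit law);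
`n = 2^k`, `hdiv` the `n`-divisibility of `E(K̄)`.  Then for every `m ∈ Sel_(n)(E_K/K)`: **`σ·m − m` is a Kummer class `κ_n(P)`, `P ∈ E(K)`.**
Proof: `ι : H¹(K, E[n]) → H¹(K, E)` maps `m` into `Ш(E_K/K)[n] ⊆ Ш(E_K/K)[2^∞]`, on which `σ = id` (`OneBit.conjH1Points_eq_self_of_shaPrimary` with
`ShaCores.corBaseChange_mem_sha`); `ι` intertwines `σ` (`torsionH1ToH1_conjAct`), so `ι(σm − m) = 0` and exactness of the Kummer sequence concludes.
[cite: GrossLMS1991, §5 (5.1)] [cite: Kramer1981, Thm. 1] [cite: SilvermanAEC2009, VIII.§2, Thm. X.4.2 (a)] [cite: SerreGaloisCohomology1997, I §2.4 Prop. 9] -/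
theorem conjAct_sub_self_mem_range_kummerMapTorsion (W : WeierstrassCurve ℚ) [W.IsElliptic] (K : Type) [Field K] [NumberField K]
    (hIQ : IsImaginaryQuadratic K) {σ : K ≃ₐ[ℚ] K} (hσ1 : σ ≠ 1)
    (hT0 : ∀ x ∈ AddCommGroup.primaryComponent (↥(W.quadraticTwist (NumberField.discr K : ℚ)).sha) 2, x = 0)
    {n : ℤ} (hn : ∃ k : ℕ, n = ((2 ^ k : ℕ) : ℤ))
    (hdiv : ∀ P : geomPoints (W.baseChange K), ∃ Q : geomPoints (W.baseChange K), n • Q = P)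
    {m : galH1Torsion (W.baseChange K) n} (hm : m ∈ selmerGroup (W.baseChange K) n) :
    conjAct W σ n m - m ∈ (kummerMapTorsion (W.baseChange K) n hdiv).range := by
  haveI : (W.baseChange K).IsElliptic := inferInstanceAs ((W.map (algebraMap ℚ K)).IsElliptic)
  obtain ⟨k, rfl⟩ := hn
  have hnz : ((2 ^ k : ℕ) : ℤ) ≠ 0 := by positivity
  -- `t := ι m ∈ Ш(E_K/K) ∩ H¹(K, E)[2^k]`
  have ht : torsionH1ToH1 (W.baseChange K) ((2 ^ k : ℕ) : ℤ) m ∈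
      (W.baseChange K).sha ⊓ AddSubgroup.torsionBy (W.baseChange K).galH1 ((2 ^ k : ℕ) : ℤ) := by
    rw [← WeierstrassCurve.map_torsionH1ToH1_selmerGroup_holds (W.baseChange K) hnz]
    exact AddSubgroup.mem_map_of_mem _ hm
  obtain ⟨htsha, httor⟩ := AddSubgroup.mem_inf.mp ht
  have hk' : ∃ j : ℕ, 2 ^ j • torsionH1ToH1 (W.baseChange K) ((2 ^ k : ℕ) : ℤ) m = 0 := by
    exact ⟨k, AddSubgroup.torsionBy.nsmul_iff.mp httor⟩
  -- `σ = id` on `Ш(E_K/K)[2^∞]`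
  have hfix := OneBit.conjH1Points_eq_self_of_shaPrimary W K hIQ hσ1 hT0
    (fun c hc ↦ ShaCores.corBaseChange_mem_sha K (W.quadraticTwist (NumberField.discr K : ℚ)) hIQ.1 hσ1 c hc) _ htsha hk'
  -- hence `ι (σm − m) = 0`, and the Kummer sequence is exact at `H¹(K, E[n])`
  apply mem_range_kummerMapTorsion_of_torsionH1ToH1_eq_zero
  rw [map_sub, torsionH1ToH1_conjAct, hfix, sub_self]

/-- The `Ш`-image form of §1: `ι(σ·m) = ι(m)` in `Ш(E_K/K)` for every `m ∈ Sel_(2^k)(E_K/K)` (same hypotheses). [cite: GrossLMS1991, §5 (5.1)]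
[cite: Kramer1981, Thm. 1] -/
theorem torsionH1ToH1_conjAct_eq_of_mem_selmerGroup (W : WeierstrassCurve ℚ) [W.IsElliptic] (K : Type) [Field K] [NumberField K]
    (hIQ : IsImaginaryQuadratic K) {σ : K ≃ₐ[ℚ] K} (hσ1 : σ ≠ 1)
    (hT0 : ∀ x ∈ AddCommGroup.primaryComponent (↥(W.quadraticTwist (NumberField.discr K : ℚ)).sha) 2, x = 0)
    (k : ℕ) {m : galH1Torsion (W.baseChange K) ((2 ^ k : ℕ) : ℤ)} (hm : m ∈ selmerGroup (W.baseChange K) ((2 ^ k : ℕ) : ℤ)) :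
    torsionH1ToH1 (W.baseChange K) ((2 ^ k : ℕ) : ℤ) (conjAct W σ ((2 ^ k : ℕ) : ℤ) m) =
      torsionH1ToH1 (W.baseChange K) ((2 ^ k : ℕ) : ℤ) m := by
  haveI : (W.baseChange K).IsElliptic := inferInstanceAs ((W.map (algebraMap ℚ K)).IsElliptic)
  have hnz : ((2 ^ k : ℕ) : ℤ) ≠ 0 := by positivity
  have ht : torsionH1ToH1 (W.baseChange K) ((2 ^ k : ℕ) : ℤ) m ∈
      (W.baseChange K).sha ⊓ AddSubgroup.torsionBy (W.baseChange K).galH1 ((2 ^ k : ℕ) : ℤ) := by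
    rw [← WeierstrassCurve.map_torsionH1ToH1_selmerGroup_holds (W.baseChange K) hnz]
    exact AddSubgroup.mem_map_of_mem _ hm
  obtain ⟨htsha, httor⟩ := AddSubgroup.mem_inf.mp ht
  have hk' : ∃ j : ℕ, 2 ^ j • torsionH1ToH1 (W.baseChange K) ((2 ^ k : ℕ) : ℤ) m = 0 := by
    exact ⟨k, AddSubgroup.torsionBy.nsmul_iff.mp httor⟩
  rw [torsionH1ToH1_conjAct]
  exact OneBit.conjH1Points_eq_self_of_shaPrimary W K hIQ hσ1 hT0
    (fun c hc ↦ ShaCores.corBaseChange_mem_sha K (W.quadraticTwist (NumberField.discr K : ℚ)) hIQ.1 hσ1 c hc) _ htsha hk'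

/-! ## §2 On the supply cruxes' frame (`Ш(E^(d_K)/ℚ)[2^∞] = 0` from gk2-p3's `exists_frame_of_cut`) -/

/-- **`σ·m − m ∈ κ_(2^k)(E(K))` for every `m ∈ Sel_(2^k)(E_K/K)` on the K4Pos / K4Neg frame** — SIGN-FREE: `ρ̄_{E,2}` onto, `K` imaginary quadratic
with Heegner hypothesis, `σ ≠ 1`; a conductor-`1` datum with `P(1)` of infinite order and `2^(M₀+1) ∤ P(1)`; `w(E) = +1`; `rank E(ℚ) = 0` (displayed;
discharged by GZK on `r_an = 0`, or on Δ<0 by `mordellWeilRank_rat_eq_zero_onHabitat` mod Q2); an elliptic model `Wd ≅ E^(d_K)` with `#Sel₂(Wd) = 2`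
(so `Ш(E^(d_K)/ℚ)[2^∞] = 0`, `exists_frame_of_cut`).  BSD is NOT proved by this. [cite: GrossLMS1991, §5 (5.1), Prop. 5.3] [cite: Kramer1981, Thm. 1]
[cite: SilvermanAEC2009, VIII.§2, Thm. X.4.2] -/
theorem conjAct_sub_self_mem_range_kummerMapTorsion_of_frame
    (W : WeierstrassCurve ℚ) [W.IsElliptic] [W.IsGloballyMinimal] [NeZero (W.conductorNorm ℤ)] (K : Type) [Field K] [NumberField K]
    (hIQ : IsImaginaryQuadratic K) (hHe : SatisfiesHeegnerHypothesis (W.conductorNorm ℤ) K)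
    (hs2 : W.HasSurjectiveModNGaloisRep 2) {σ : K ≃ₐ[ℚ] K} (hσ1 : σ ≠ 1)
    (Dt : ModularParametrizationData W (W.conductorNorm ℤ)) (β : ℤ) (ι : K →+* ℂ) (d₁ : KolyvaginHeegnerData Dt β ι 1)
    (hy : ¬ IsOfFinAddOrder d₁.derivedPoint) (M₀ : ℕ)
    (hndiv : ¬ ∃ Q : (W.baseChange (ringClassField K ι 1)).toAffine.Point, ((2 ^ (M₀ + 1) : ℕ) : ℤ) • Q = d₁.derivedPoint)
    (hw : W.rootNumber = 1) (hrk0 : W.mordellWeilRank = 0)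
    (Wd : WeierstrassCurve ℚ) [Wd.IsElliptic] (hWd : ∃ C : VariableChange ℚ, C • W.quadraticTwist (NumberField.discr K : ℚ) = Wd)
    (hSel : Nat.card (Wd.selmerGroup 2) = 2)
    {n : ℤ} (hn : ∃ k : ℕ, n = ((2 ^ k : ℕ) : ℤ))
    (hdiv : ∀ P : geomPoints (W.baseChange K), ∃ Q : geomPoints (W.baseChange K), n • Q = P)
    {m : galH1Torsion (W.baseChange K) n} (hm : m ∈ selmerGroup (W.baseChange K) n) :
    conjAct W σ n m - m ∈ (kummerMapTorsion (W.baseChange K) n hdiv).range := by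
  obtain ⟨-, -, -, hT0⟩ := exists_frame_of_cut W K hIQ hHe hs2 hσ1 Dt β ι d₁ hy M₀ hndiv hw hrk0 Wd hWd hSel
  exact conjAct_sub_self_mem_range_kummerMapTorsion W K hIQ hσ1 hT0 hn hdiv hm

/-! ## §3 The K₄⁺ cell at level `2`: `(σ − 1)·Sel₂(E_K/K) = {0, κ₂(Q₀)}` and it is NOT zero -/

/-- **ON THE K₄⁺ CELL, `κ₂(Q₀) ∈ (σ − 1)·Sel₂(E_K/K)` FOR EVERY `Q₀ ∈ E(K) ∖ 2E(K)`** — in particular for `Q₀ = y_K/2^(M₀)` (the point whose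
Kummer class descends to the capitulating class `s_y`, g35/LEAD capitulation package): «`u₀ = κ₂(y_K/2^(M₀))`» of the g36 memo holds UNCONDITIONALLY
(no K₄, no depth hypothesis), so it is not a depth-two instrument.  Cell binders as in g35's `natCard_shaTorsionBy_two_baseChange_eq_four_of_kFourPos`
(`E/ℚ` globally minimal, `Δ_E > 0`, `ρ̄_{E,2}` onto, `C(E)` odd, the K₄⁺ clause; `K` imaginary quadratic, `d_K` odd, Heegner, `2` split, `σ ≠ 1`;
`Wd = Cd • E^(d_K)` elliptic with `ord₂ C(Wd) = 0`; `rank E(K) = 1`; `Ш(E_K/K)[2^∞]` finite) + `E(K)[2] = 0` is automatic + the displayed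
`Ш(E^(d_K)/ℚ)[2^∞] = 0` (`hT0`, = §2's frame).  Proof: §1 puts `σm − m` in `κ₂(E(K)) = {0, κ₂(Q₀)}` (`kummerMapTorsion_eq_zero_or_eq_of_rank_one`);
if it were `0` for all `m`, every class would be `σ`-fixed, but `#Sel₂(E_K/K)^σ = 4` and `#Sel₂(E_K/K) = 8`.  BSD is NOT proved by this.
[cite: GrossLMS1991, §5 (5.1)] [cite: Kramer1981, Thm. 1] [cite: McCallumLMS1991, §5] [cite: SilvermanAEC2009, Thm. X.4.2] -/
theorem exists_conjAct_sub_self_eq_kummerMapTorsion_of_kFourPos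
    (W : WeierstrassCurve ℚ) [W.IsElliptic] [W.IsGloballyMinimal] (K : Type) [Field K] [NumberField K]
    (hpos : 0 < W.Δ) (hs2 : W.HasSurjectiveModNGaloisRep 2) (hTam : Odd W.tamagawaProduct)
    (h4 : Nat.card (W.selmerGroup 2) = 4 ∧ ∃ c ∈ (W.kummerSelmerStructure ((2 : ℕ) : ℤ)).selmerGroup,
      galoisCohomology.localization (W.torsionGaloisModule ((2 : ℕ) : ℤ)) (Sum.inl Rat.infinitePlace) 1 c ≠ 0)
    (hIQ : IsImaginaryQuadratic K) (hodd : Odd (discr K)) (hHe : SatisfiesHeegnerHypothesis (W.conductorNorm ℤ) K)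
    (h2K : ((Ideal.span {(2 : ℤ)}).primesOver (𝓞 K)).ncard = 2) {σ : K ≃ₐ[ℚ] K} (hσ1 : σ ≠ 1)
    {Wd : WeierstrassCurve ℚ} [Wd.IsElliptic] (Cd : VariableChange ℚ) (hCd : Cd • W.quadraticTwist (discr K : ℚ) = Wd)
    (hDEF : padicValNat 2 Wd.tamagawaProduct = 0)
    (hrk : (W.baseChange K).mordellWeilRank = 1) [Finite (AddCommGroup.primaryComponent (W.baseChange K).sha 2)]
    (hT0 : ∀ x ∈ AddCommGroup.primaryComponent (↥(W.quadraticTwist (NumberField.discr K : ℚ)).sha) 2, x = 0)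
    {Q₀ : (W.baseChange K).toAffine.Point} (hQ₀ : ¬ ∃ R : (W.baseChange K).toAffine.Point, (2 : ℤ) • R = Q₀) :
    ∃ m ∈ selmerGroup (W.baseChange K) ((2 : ℕ) : ℤ),
      conjAct W σ ((2 : ℕ) : ℤ) m - m = kummerMapTorsion (W.baseChange K) ((2 : ℕ) : ℤ) (GenusKolyArch.hdiv_two_baseChange W K) Q₀ := by
  haveI : Fact (Nat.Prime 2) := ⟨Nat.prime_two⟩
  haveI : (W.baseChange K).IsElliptic := inferInstanceAs ((W.map (algebraMap ℚ K)).IsElliptic)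
  have h2t : ∀ T : (W.baseChange K).toAffine.Point, (2 : ℤ) • T = 0 → T = 0 := fun T hT ↦
    KFourPosCell.forall_two_smul_eq_zero_baseChange_of_kFourPos W K hs2 hIQ.1 T (by simpa using hT)
  -- the counts: `#Sel₂(E_K)^σ = 4`, `#Sel₂(E_K) = 8`
  have hfix4 := KFourPosCell.natCard_fixedSelmer_eq_four_of_kFourPos W K hpos hs2 hTam h4 hIQ hodd hHe h2K hσ1 Cd hCd hDEF
  have hSel8 := (KFourPosCell.natCard_shaTorsionBy_two_baseChange_eq_four_of_kFourPos W K hpos hs2 hTam h4 hIQ hodd hHe h2K hσ1 Cd hCd hDEF hrk).2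
  -- a non-fixed Selmer class exists
  by_contra hno
  push Not at hno
  have hall : ∀ m ∈ selmerGroup (W.baseChange K) ((2 : ℕ) : ℤ), conjAct W σ ((2 : ℕ) : ℤ) m = m := by
    intro m hm
    have hmem := conjAct_sub_self_mem_range_kummerMapTorsion W K hIQ hσ1 hT0 ⟨1, by norm_num⟩ (GenusKolyArch.hdiv_two_baseChange W K) hm
    obtain ⟨P, hP⟩ := AddMonoidHom.mem_range.mp hmem
    rcases KFourPosCell.kummerMapTorsion_eq_zero_or_eq_of_rank_one W K hrk h2t hQ₀ P with h0 | hQ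
    · rw [h0] at hP
      exact (sub_eq_zero.mp hP.symm)
    · exact absurd (hP.symm.trans hQ) (hno m hm)
  -- then every Selmer class is fixed: `#Sel₂(E_K) = #Sel₂(E_K)^σ`, i.e. `8 = 4`
  have hcard : Nat.card {m : galH1Torsion (W.baseChange K) ((2 : ℕ) : ℤ) //
      m ∈ selmerGroup (W.baseChange K) ((2 : ℕ) : ℤ) ∧ conjAct W σ ((2 : ℕ) : ℤ) m = m} =
      Nat.card (selmerGroup (W.baseChange K) ((2 : ℕ) : ℤ)) :=
    Nat.card_congr
      { toFun := fun x ↦ ⟨x.1, x.2.1⟩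
        invFun := fun x ↦ ⟨x.1, x.2, hall x.1 x.2⟩
        left_inv := fun x ↦ rfl
        right_inv := fun x ↦ rfl }
  rw [hfix4, hSel8] at hcard
  omega

end Summit.BirchSwinnertonDyer.BirchSwinnertonDyer.Theorems.GenusExact.PlusDescent

end
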